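/-
Copyright (c) 2026. All rights reserved.
Released under Apache 2.0 license as described in the file LICENSE.
Authors: abc-iut cell, prover seat abc-iut-w5-d144 (gen 6; row «COR510iv-SB′», brick E input), over abc-iut-w5-d053's
`LogFrobeniusObservablesTSOfPlus.lean` (`pushFamily`) and `LogFrobeniusObservablesTSPush.lean` (`logObsFamilyTS_push`).
-/
import Literature.AnabelianGeometry.AbsoluteAnabelian.Ltimes.LogFrobeniusObservablesTSPush
import Literature.AnabelianGeometry.AbsoluteAnabelian.Ltimes.LogFrobeniusIncompatibility
import HarnessLib
import Literature.AnabelianGeometry.AbsoluteAnabelian.LogFrobeniusObservablesTSPushSubFamily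

/-!
# [AbsTopIII] Cor 5.5 (iii): `S_log_v` CONTAINS the push-forward `S_log⊞_v ▷ (𝒩⊞_v → 𝒩_v)` as a SUB-FAMILY

S. Mochizuki, *Topics in absolute anabelian geometry III: global reconstruction algorithms*,
J. Math. Sci. Univ. Tokyo 22 (2015) 939–1156 [MochizukiAbsTopIII2015]; manuscript `paper:url-5493eb38cbb7`: Cor 5.5 (iii)
p. 131 ("the families of homotopies that constitute `S_log` and `S_log⊞` are compatible with one another"), Def 5.4 (vii)
p. 128 (`ι_{v,ε}` = `ι⊞_{v,ε}` composed with `𝒩⊞_v → 𝒩_v` on the edges of `Γ⃗^⋉_v`), Def 3.5 (ii) p. 75.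

PROOF-ONLY glue for brick E of the Cor 5.10 (iv)(b) compatibility closer (row «COR510iv-SB′»; abc-iut-f-101's D2 binder
`hpush v : SubFamily (pushFamily (Hplus v)) (Hts v)`, 2026-08-27T03:03:45Z): for the CONSTRUCTED observables
`Hplus := logObsFamily v hsq` (abc-iut-f-101) and `Hts := logObsFamilyTS v T hsqTS` (abc-iut-L4-t5), abc-iut-w5-d053's
push-forward family `pushFamily (L.logObsFamily v hsq)` (boundary pairs `([p]·[𝒩⊞_v → 𝒩_v], [q]·[𝒩⊞_v → 𝒩_v])` for the
boundary pairs `(p, q)` of `S_log⊞_v`, homotopies whiskered by `𝒩⊞_v → 𝒩_v`) is a SUB-FAMILY of `S_log_v`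
(abc-iut-L4-t3's `SubFamily`: same boundary pairs, literally equal homotopies) — assembled from abc-iut-w5-d053's chain-map
theorem `logObsFamilyTS_push(_app)` and the componentwise description `pushFamily_η_app_heq` of the push-forward.

* `subFamily_pushFamily_logObsFamilyTS` — ★ `SubFamily (pushFamily (L.logObsFamily v hsq)) (L.logObsFamilyTS v T hsqTS)`,
  for EVERY setting `L`, place `v`, `TS`-datum `T` and square hypotheses `hsq`, `hsqTS` (generic; no carrier).

Nothing here bears on [IUTchIII] Cor. 3.12; interface-level bookkeeping; no side taken; typed ≠ proved.

**`⋉`-TWIN (cell row «LTIMES-SUCCESSOR», L4-lead m162; typing finding T3g9-F1).**  This file is the verbatim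
re-elaboration of `LogFrobeniusObservablesTSPushSubFamily.lean` over the successor interface `LogFrobeniusSettingLtimes`
(`Ltimes/LogFrobeniusCompatibility.lean`: `ι⊞_{v,ε}` indexed by the edges of `Γ⃗^⋉_v` at EVERY place, [AbsTopIII] Cor 5.5 (iii)
p. 131), produced by the cell recipe `LTIMES-RECIPE.md`: names carry over inside `namespace LogFrobeniusSettingLtimes`, the
section variable is `Lt`, setting-independent declarations are NOT repeated (the originals are in scope), statements and
proofs are otherwise unchanged.  The original file over the frozen interface stays as it is.
SLICE T9-E (abc-iut-f-101 gen 6): ★ `subFamily_pushFamily_logObsFamilyTS` (the hpush binder of the E-instance) over ⋉, verbatim.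
-/

universe u

open CategoryTheory Quiver

namespace Literature.AnabelianGeometry.AbsoluteAnabelian

namespace LogFrobeniusSettingLtimes

variable {Vmod : Type u} {isArc : Vmod → Bool} (Lt : LogFrobeniusSettingLtimes Vmod isArc) (v : Vmod) (T : Lt.TSHomotopies)

/-- ★ **`S_log⊞_v ▷ (𝒩⊞_v → 𝒩_v) ⊆ S_log_v` as families of homotopies** (Cor 5.5 (iii), "compatible with one another", for
the constructed observables): every boundary pair of abc-iut-w5-d053's push-forward of `logObsFamily v hsq` is a boundary
pair of `logObsFamilyTS v T hsqTS` with the SAME homotopy.  Proof: a pushed pair is presented by a `⊞`-pair `(p, q)`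
(`PushPair`); abc-iut-w5-d053's `logObsFamilyTS_push_app` and `pushFamily_η_app_heq` say that both homotopies have
component `(𝒩⊞_v → 𝒩_v)(ζ_{p,q,X})` at every object `X`, up to the canonical casts.
[cite: MochizukiAbsTopIII2015, Cor 5.5 (iii) p. 131] -/
theorem subFamily_pushFamily_logObsFamilyTS (hsq : Lt.IotaSquaresCommute v) (hsqTS : Lt.IotaSquaresCommuteTS T v) :
    SubFamily (pushFamily (Lt.logObsFamily v hsq)) (Lt.logObsFamilyTS v T hsqTS) := by
  intro a' b' p' q' h
  obtain ⟨w⟩ := (pushFamily_E (Lt.logObsFamily v hsq) p' q').mp h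
  obtain ⟨x, p, q, mem, src, tgt, left, right⟩ := w
  subst src tgt
  obtain rfl := eq_of_heq left
  obtain rfl := eq_of_heq right
  obtain ⟨h', -⟩ := Lt.logObsFamilyTS_push v T hsq hsqTS p q mem
  refine ⟨h', ?_⟩
  ext X₀
  obtain ⟨h'', e⟩ := Lt.logObsFamilyTS_push_app v T hsq hsqTS p q mem X₀
  -- `h''` and `h'` prove the same proposition: restate `e` at `h'`
  have e' : ((Lt.logObsFamilyTS v T hsqTS).η h').app X₀ = _ := e
  refine Eq.trans ?_ e'.symm
  exact (eqToHom_conj_eq_of_heq _ _ _ _ (pushFamily_η_app_heq (Lt.logObsFamily v hsq) x mem h X₀).symm).symm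

/-- Pointwise-in-`v` form packaged as the binder `hpush` of abc-iut-f-101's sufficiency theorem (brick D2) for the pair
`(logObsFamily, logObsFamilyTS)`. [cite: MochizukiAbsTopIII2015, Cor 5.5 (iii) p. 131] -/
theorem subFamily_pushFamily_logObsFamilyTS_forall (hsq : ∀ v, Lt.IotaSquaresCommute v)
    (hsqTS : ∀ v, Lt.IotaSquaresCommuteTS T v) (v : Vmod) :
    SubFamily (pushFamily (Lt.logObsFamily v (hsq v))) (Lt.logObsFamilyTS v T (hsqTS v)) :=
  Lt.subFamily_pushFamily_logObsFamilyTS v T (hsq v) (hsqTS v)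

end LogFrobeniusSettingLtimes

end Literature.AnabelianGeometry.AbsoluteAnabelian
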